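import Summits.QuantumFields.YangMills.Theorems.BalabanUVNodesN06AtRecord9CB10Y
import Literature.MathematicalPhysics.QuantumFieldTheory.Balaban1983to89.Node00.Record11CarriersB8Sub
import Literature.MathematicalPhysics.QuantumFieldTheory.Balaban1983to89.B8LeafKnitZd3Letters

/-!
# BalabanUVNodes ∕ N05 ([B8], `Dag.B8_main`) AT NODE 00's SIX-PIN STAGE-11 RECORD OVER THE SUB-INDEX OF RECORD, `Node00.IsRecordOfRecord₁₁CB10YZWB8subB12` —
# READINGS · CLOSERS BY NAME in both currencies · GUARDS (the ∀-form is STILL refuted under inhabitation through the residual [B8] layer; what N05 costs at the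
# sub-family pin in K1's ∃-currency = the slot `B8LeafOfRecordSub θ₃ λ` for a NAMED `λ`)

Track A of `YM-PLAN.md` (cell `pub-ymgap`, HUMAN RULING D-0062), node **N05** = [Balaban1985RegularSpaces] Lemma 1, Thm 2, Prop 3, Thm 4, Props 5–7, Thm 8; R134
fan-out seat `pub-ymgap-dag-n05-d` (strategy s2 = BY-NAME KNIT ∕ REDUCTION at the ₁₁ record).  Sequel of this seat's `BalabanUVNodesN05AtRecord11CB10YZWB8` (p452595,
the FIVE-pin record over the FULL admitted index `IdxB8`): after this seat's LOCATED-1 ∕ ref-A's junction flag J2 (the knit's Prop-5 socket binder `∀ i : ZdIdx, SockHFP …`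
is unsatisfiable at members with free lower truncations) node00-def g32 RE-KEYED the [B8] group over THE SUB-INDEX OF RECORD `IdxB8Sub θ = {i : IdxB8 θ // IdxB8Laws θ.L i.1}`
(index laws №7 `scale`, №8 `trunc_lt`∕`trunc_top`, №11 `cover`; `tower_all` a theorem) — `Node00/CarriersB8Sub.lean` (p456719 ∕ p458424: `B8LeafOfRecordSub θ λ` = the
surviving leaf over `fun j : IdxB8Sub θ => famB8OfRecord θ β len j.1`), `Node00/Record11CarriersB8Sub.lean` (the six-pin record `IsRecordOfRecord₁₁CB10YZWB8subB12`, its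
companion, faces and the slots closer `b8_main_of_isRecordOfRecord₁₁CB10YZWB8subB12_of_slots`).  This module says what N05 IS there, BY NAME; the letters-fed sub-family knit
(`B8SockHFPOfSockLetters.exists_threshold_sockHFP_pair` composed with n05-a g7's ι-generic chain `B8LeafKnitZd3E`) enters as the SLOT `B8LeafOfRecordSub θ₃ λ` and lands as
a v1.1 append (`b8LeafOfRecordSub_of_knit_lettersE`).  Kernel bookkeeping: 0 `def`, 0 `sorry`, standard axioms.  COUNT-NEUTRAL; `--supports` K1 `StabilityBAtRecordR11e`
(stmt-QuantumFields-19674).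

WHAT THIS MODULE PROVES.
* §1 READINGS: `s_N05_iff₁₁CB10YZWB8subB12` (`Iff.rfl`) · `b8_main_iff_edge_of_…` (N05 IS «`b9 → b8`»; in-edges `b4 b5 b6 b7` by g32's companion + ₅C shadow) ·
  `b8_main_iff_bundles_of_…` (through the pinned bundles: «`B9LeafX (Y9OfRecord …) → B8LeafOfRecordSub θ₃ λ`») · `s_N05_iff_edge₁₁CB10YZWB8subB12`.
* §2 CLOSERS BY NAME — ∀-currency: `s_N05_record₁₁CB10YZWB8subB12_of_edgeSlot`, `s_N05_of_refines₁₁CB10YZWB8subB12`; ∃-currency (K1 V1, the prover CHOOSES the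
  package incl. `λ`): `b8_main_of_up_view₁₁B12B8subB10YZW` (edge form) and `b8_main_of_up_view₁₁B12B8subB10YZW_of_leafSub` (slot form: the sub-family leaf
  `B8LeafOfRecordSub θ₃ λ` at the chosen package gives `Dag.B8_main` at every run of any world bound over g32's six-pin view).
* §3 GUARDS: `exists_residB8_not_b8LeafOfRecordSub` (the re-key to the sub-INDEX does not touch the residual [B8] layer: a degenerate Prop-5 family still refutes the
  leaf — g31's `exists_residB8_not_b8LeafOfRecord` verbatim at the sub-family) · `exists_record₁₁CB10YZWB8subB12_leaves_iff` · `s_N05_iff₁₁CB10YZWB8subB12_bundles` ·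
  **`not_s_N05_record₁₁CB10YZWB8subB12`** (ONE admissible Stage-11 parameter with provisos and `γ > 0` REFUTES the ∀-form at the six-pin Sub record too: junk operator
  layer ⇒ b9 leaf TRUE, junk residual [B8] layer ⇒ b8 leaf FALSE; the index re-key cures J2 — the SOCKET binder — not the ∀-form's `λ`-junk; the count line is the
  ∃∕slots form with a NAMED `λ`) · `inhabited₁₁CB10YZWB8subB12_iff_inhabited₁₁C` · `exists_rebind₁₁CB10YZWB8subB12_of_isRecordOfRecord₁₁C` (K1-currency, LOCATED: every
  ₁₁C record is re-presented, for EVERY `λ` of the prover's choice, by a six-pin Sub world with `Dag.B8_main ⟺ B8LeafOfRecordSub θ₃ λ` at every run).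

HONEST FRAMING.  [B8]'s theorems are NOT proved here for Bałaban's objects; every closer takes the leaf ∕ the edge slot AS HYPOTHESES; N05 is NOT discharged (typed 28∕28,
discharged 5∕27 untouched); one finite four-torus programme at fixed `ε` — NOT ℝ⁴, NOT infinite volume, NOT OS, NOT a mass gap, NOT Clay.  Restate-immune (no `def`).
-/

noncomputable section

namespace Summit.QuantumFields.YangMills.BalabanUVNodes.N05AtRecord11Sub

open Literature.MathematicalPhysics.QuantumFieldTheory.Balaban1983to89
open Literature.MathematicalPhysics.QuantumFieldTheory.Balaban1983to89.T4Continuum (T4Family FiniteEpsData)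
open Literature.MathematicalPhysics.QuantumFieldTheory.Balaban1983to89.DagBinding (WorldP leavesP B9LeafX)
open Literature.MathematicalPhysics.QuantumFieldTheory.Balaban1983to89.Node00
open Literature.MathematicalPhysics.QuantumFieldTheory.Balaban1983to89.B9PinMembersKLevelV1 (MemberY geo9Y bg9Y)
open Literature.MathematicalPhysics.QuantumFieldTheory.Balaban1983to89.B7Prop2SpecialUnitary (specialUnitaryUnits)
open YMDAG.UVSplit (RecordPred Datum AtRecord S_N05)
open Summit.QuantumFields.YangMills.BalabanUVNodes.N06AtRecord9CB10Y (exists_junkOps_b9LeafX_Y9OfRecord)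
open scoped Matrix.Norms.L2Operator

variable {N : ℕ} [NeZero N]

/-! ## §1 readings at the six-pin Stage-11 record over the sub-index -/

/-- **What `S_N05` says over the six-pin Sub record** (`Iff.rfl`). [cite: Balaban1985RegularSpaces, Lemma 1 – Thm 8 pp.79–101 (the node's shape `Dag.B8_main`, bookkeeping)] -/
theorem s_N05_iff₁₁CB10YZWB8subB12 :
    S_N05 (fun F D w => IsRecordOfRecord₁₁CB10YZWB8subB12 F N D w) ↔
      ∀ (F : T4Family) (D : Datum F N) (w : WorldP), IsRecordOfRecord₁₁CB10YZWB8subB12 F N D w → ∀ P : B12.RunParams, Dag.B8_main (leavesP w P) :=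
  Iff.rfl

section Record

variable {F : T4Family} {D : FiniteEpsData F (Node00.SU N)} {w : WorldP}

/-- **At a six-pin Sub record N05 IS THE EDGE «`b9 → b8`»** (g32's `b8_b11_b10_main_iff_of_isRecordOfRecord₁₁CB10YZWB8subB12`, first conjunct, pointed).
[cite: Balaban1985RegularSpaces, Thm 2 p.83, Thm 8 p.101 (bookkeeping)] -/
theorem b8_main_iff_edge_of_isRecordOfRecord₁₁CB10YZWB8subB12 (h : IsRecordOfRecord₁₁CB10YZWB8subB12 F N D w) (P : B12.RunParams) :
    Dag.B8_main (leavesP w P) ↔ ((leavesP w P).b9 → (leavesP w P).b8) :=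
  (b8_b11_b10_main_iff_of_isRecordOfRecord₁₁CB10YZWB8subB12 h P).1

/-- **At a six-pin Sub record N05 IS «def-Y's extended [B9] leaf → the surviving [B8] leaf OVER THE SUB-FAMILY» AT THE BUNDLES OF RECORD** of the presenting package
(g32's `nodes_iff_bundles_of_isRecordOfRecord₁₁CB10YZWB8subB12`, first conjunct). [cite: Balaban1985RegularSpaces, Lemma 1 – Thm 8 pp.79–101; Balaban1985BackgroundPropagators, Thm 3.1 p.397 (bookkeeping)] -/
theorem b8_main_iff_bundles_of_isRecordOfRecord₁₁CB10YZWB8subB12 (h : IsRecordOfRecord₁₁CB10YZWB8subB12 F N D w) :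
    ∃ (θ : Stage11Params F N) (lam : ResidB8 θ.toStage3Params) (Mstar : ℕ) (ops : OpsY N θ.toStage3Params Mstar), θ.Admissible ∧ w.L = (θ.L : ℝ) ∧
      ∀ P : B12.RunParams,
        Dag.B8_main (leavesP w P) ↔ (B9LeafX (Y9OfRecord N θ.toStage3Params Mstar ops) → B8LeafOfRecordSub θ.toStage3Params lam) := by
  obtain ⟨θ, lam, Mstar, ops, ζ, hθ, hL, hl⟩ := nodes_iff_bundles_of_isRecordOfRecord₁₁CB10YZWB8subB12 h
  exact ⟨θ, lam, Mstar, ops, hθ, hL, fun P => (hl P).1⟩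

end Record

/-- **`S_N05` over the six-pin Sub record IS «`b9 → b8` at every run of every record»**. [cite: Balaban1985RegularSpaces, Lemma 1 – Thm 8 pp.79–101 (bookkeeping)] -/
theorem s_N05_iff_edge₁₁CB10YZWB8subB12 :
    S_N05 (fun F D w => IsRecordOfRecord₁₁CB10YZWB8subB12 F N D w) ↔
      ∀ (F : T4Family) (D : Datum F N) (w : WorldP), IsRecordOfRecord₁₁CB10YZWB8subB12 F N D w →
        ∀ P : B12.RunParams, (leavesP w P).b9 → (leavesP w P).b8 :=
  ⟨fun h F D w hR P => (b8_main_iff_edge_of_isRecordOfRecord₁₁CB10YZWB8subB12 hR P).1 (h F D w hR P),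
    fun h F D w hR P => (b8_main_iff_edge_of_isRecordOfRecord₁₁CB10YZWB8subB12 hR P).2 (h F D w hR P)⟩

/-! ## §2 closers BY NAME — ∀-currency (the stub `S_N05`) and ∃-currency (K1's V1 ∃-form) -/

/-- **N05 AT ONE six-pin Sub RECORD FROM ITS EDGE SLOT, PACKAGE FORM**: if for every package PRESENTING the record def-Y's extended [B9] leaf implies the sub-family [B8]
leaf, then `Dag.B8_main` at every run (g32's `b8_main_of_isRecordOfRecord₁₁CB10YZWB8subB12_of_slots` is the b9-free special case). [cite: Balaban1985RegularSpaces, Lemma 1 – Thm 8 pp.79–101 (bookkeeping)] -/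
theorem b8_main_of_isRecordOfRecord₁₁CB10YZWB8subB12_of_edgeSlot {F : T4Family} {D : Datum F N} {w : WorldP} (h : IsRecordOfRecord₁₁CB10YZWB8subB12 F N D w)
    (hB : ∀ (θ : Stage11Params F N) (hP : θ.Provisos₁₁) (lam12 : ResidB12 F N θ.τ9.M) (lam : ResidB8 θ.toStage3Params) (Mstar : ℕ)
      (ops : OpsY N θ.toStage3Params Mstar) (ζ : ResidZ F N) (lamW : ResidW F N), θ.Admissible → D = datumOfRecord₁₁ F N θ hP →
        (∀ P, w.up P = upOfRecord₅CS F N (θ.view₁₁B12B8subB10YZW F N lam12 lam Mstar ops ζ lamW) P) →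
          B9LeafX (Y9OfRecord N θ.toStage3Params Mstar ops) → B8LeafOfRecordSub θ.toStage3Params lam)
    (P : B12.RunParams) : Dag.B8_main (leavesP w P) := by
  obtain ⟨θ, hP, lam12, lam, Mstar, ops, ζ, lamW, hθ, hD, -, -, -, hup⟩ := h
  intro _ _ _ h9
  have h9' : (w.up P).b9 := h9
  rw [hup P] at h9'
  show (w.up P).b8
  rw [hup P]
  exact (upOfRecord₅CS_view₁₁B12B8subB10YZW_leaves F N θ lam12 lam Mstar ops ζ lamW P).2.1.2
    (hB θ hP lam12 lam Mstar ops ζ lamW hθ hD hup ((upOfRecord₅CS_view₁₁B12B8subB10YZW_leaves F N θ lam12 lam Mstar ops ζ lamW P).2.2.2.1.1 h9'))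

/-- **`S_N05` over the six-pin Sub record FROM THE EDGE SLOT, PACKAGE FORM** (`…_of_edgeSlot` at every record; §3 says the slot is unsatisfiable over junk `λ`).
[cite: Balaban1985RegularSpaces, Lemma 1 – Thm 8 pp.79–101 (bookkeeping)] -/
theorem s_N05_record₁₁CB10YZWB8subB12_of_edgeSlot
    (hslot : ∀ (F : T4Family) (D : Datum F N) (w : WorldP), IsRecordOfRecord₁₁CB10YZWB8subB12 F N D w →
      ∀ (θ : Stage11Params F N) (hP : θ.Provisos₁₁) (lam12 : ResidB12 F N θ.τ9.M) (lam : ResidB8 θ.toStage3Params) (Mstar : ℕ)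
        (ops : OpsY N θ.toStage3Params Mstar) (ζ : ResidZ F N) (lamW : ResidW F N), θ.Admissible → D = datumOfRecord₁₁ F N θ hP →
          (∀ P, w.up P = upOfRecord₅CS F N (θ.view₁₁B12B8subB10YZW F N lam12 lam Mstar ops ζ lamW) P) →
            B9LeafX (Y9OfRecord N θ.toStage3Params Mstar ops) → B8LeafOfRecordSub θ.toStage3Params lam) :
    S_N05 (fun F D w => IsRecordOfRecord₁₁CB10YZWB8subB12 F N D w) :=
  fun F D w h P => b8_main_of_isRecordOfRecord₁₁CB10YZWB8subB12_of_edgeSlot h (hslot F D w h) P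

/-- **`S_N05 Rec` FOR EVERY RECORD PREDICATE REFINING the six-pin Sub record**, from the BUNDLE slot «b9-leaf → sub-family b8-leaf for every Stage-3 dictionary with
admissible Stage-1 part, EVERY residual [B8] layer, floor and operator layer» (what a proof of the ∀-form must supply; unsatisfiable as typed — §3). [cite: Balaban1985RegularSpaces, Lemma 1 – Thm 8 pp.79–101 (bookkeeping)] -/
theorem s_N05_of_refines₁₁CB10YZWB8subB12 (Rec : RecordPred N)
    (href : ∀ (F : T4Family) (D : Datum F N) (w : WorldP), Rec F D w → IsRecordOfRecord₁₁CB10YZWB8subB12 F N D w)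
    (hslot : ∀ (θ₃ : Stage3Params), θ₃.toStage1Params.Admissible → ∀ (lam : ResidB8 θ₃) (Mstar : ℕ) (ops : OpsY N θ₃ Mstar),
      B9LeafX (Y9OfRecord N θ₃ Mstar ops) → B8LeafOfRecordSub θ₃ lam) :
    S_N05 Rec := by
  intro F D w hR P
  obtain ⟨θ, lam, Mstar, ops, hθ, -, hiff⟩ := b8_main_iff_bundles_of_isRecordOfRecord₁₁CB10YZWB8subB12 (href F D w hR)
  exact (hiff P).2 (hslot θ.toStage3Params hθ.1.1.1.1.1 lam Mstar ops)

section Pointed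

variable {F : T4Family}

/-- **N05 AT ANY WORLD BOUND OVER g32's SIX-PIN VIEW WITH [B8′], FROM THE EDGE AT THE CHOSEN PACKAGE** (`λ` included in the choice): «b9-leaf → `B8LeafOfRecordSub θ₃ λ`»
gives `Dag.B8_main` at every run.  The shape K1's prover consumes. [cite: Balaban1985RegularSpaces, Lemma 1 – Thm 8 pp.79–101 (bookkeeping)] -/
theorem b8_main_of_up_view₁₁B12B8subB10YZW (θ : Stage11Params F N) (lam12 : ResidB12 F N θ.τ9.M) (lam : ResidB8 θ.toStage3Params) (Mstar : ℕ)
    (ops : OpsY N θ.toStage3Params Mstar) (ζ : ResidZ F N) (lamW : ResidW F N) (w : WorldP)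
    (hup : ∀ P, w.up P = upOfRecord₅CS F N (θ.view₁₁B12B8subB10YZW F N lam12 lam Mstar ops ζ lamW) P)
    (hedge : B9LeafX (Y9OfRecord N θ.toStage3Params Mstar ops) → B8LeafOfRecordSub θ.toStage3Params lam) (P : B12.RunParams) :
    Dag.B8_main (leavesP w P) := by
  intro _ _ _ h9
  have h9' : (w.up P).b9 := h9
  rw [hup P] at h9'
  show (w.up P).b8
  rw [hup P]
  exact (upOfRecord₅CS_view₁₁B12B8subB10YZW_leaves F N θ lam12 lam Mstar ops ζ lamW P).2.1.2
    (hedge ((upOfRecord₅CS_view₁₁B12B8subB10YZW_leaves F N θ lam12 lam Mstar ops ζ lamW P).2.2.2.1.1 h9'))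

/-- **… FROM THE SUB-FAMILY LEAF AT THE CHOSEN PACKAGE** (slot form: the b9 edge unused). The letters-fed knit supplies this slot (v1.1 `b8LeafOfRecordSub_of_knit_lettersE`).
[cite: Balaban1985RegularSpaces, Lemma 1 – Thm 8 pp.79–101 (bookkeeping)] -/
theorem b8_main_of_up_view₁₁B12B8subB10YZW_of_leafSub (θ : Stage11Params F N) (lam12 : ResidB12 F N θ.τ9.M) (lam : ResidB8 θ.toStage3Params) (Mstar : ℕ)
    (ops : OpsY N θ.toStage3Params Mstar) (ζ : ResidZ F N) (lamW : ResidW F N) (w : WorldP)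
    (hup : ∀ P, w.up P = upOfRecord₅CS F N (θ.view₁₁B12B8subB10YZW F N lam12 lam Mstar ops ζ lamW) P)
    (hleaf : B8LeafOfRecordSub θ.toStage3Params lam) (P : B12.RunParams) : Dag.B8_main (leavesP w P) :=
  b8_main_of_up_view₁₁B12B8subB10YZW θ lam12 lam Mstar ops ζ lamW w hup (fun _ => hleaf) P

end Pointed

/-! ## §3 guards — the ∀-form over the six-pin Sub record is still not an N05 target; what N05 costs there in K1's ∃-currency -/

section Guards

variable {F : T4Family}

/-- **THE RE-KEY TO THE SUB-INDEX DOES NOT TOUCH THE RESIDUAL [B8] LAYER**: a residual layer whose Proposition-5 family has ONE member with a satisfiable hypothesis (1.69) and NO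
Landau-gauge solutions makes `p5e` — hence the SUB-FAMILY leaf — FAIL (g31's `exists_residB8_not_b8LeafOfRecord`, verbatim at `B8LeafOfRecordSub`).
[cite: Balaban1985RegularSpaces, Prop. 5 p.94 (bookkeeping: the typed existence clause reads the residual carriers)] -/
theorem exists_residB8_not_b8LeafOfRecordSub (θ : Stage3Params) : ∃ lam : ResidB8 θ, ¬ B8LeafOfRecordSub θ lam := by
  obtain ⟨lam₀⟩ := nonempty_residB8 (θ := θ)
  refine ⟨{ lam₀ with I8c := PUnit, lan := fun _ => ⟨PUnit, PEmpty, fun _ _ _ => True, fun l => l.elim, fun _ l => l.elim⟩ }, fun h => ?_⟩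
  obtain ⟨c₂, hc₂, hE⟩ := h.p5e
  obtain ⟨l, -⟩ := hE PUnit.unit (c₂ / 2) (c₂ / 2) (by linarith) (by linarith) (by linarith) PUnit.unit trivial
  exact l.elim

/-- **A WORLD PRESENTED BY A GIVEN PACKAGE, six pins exposed**: every admissible Stage-11 parameter with provisos and `γ > 0`, every `λ₁₂, λ, M⋆, ops, ζ, λ_W` present a record
`(datumOfRecord₁₁ θ h, w)` whose `b8` leaf IS `B8LeafOfRecordSub θ₃ λ` and whose `b9` leaf IS `B9LeafX (Y9OfRecord N θ₃ M⋆ ops)` at every run.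
[cite: Balaban1985RegularSpaces, Lemma 1 – Thm 8 pp.79–101; Balaban1985BackgroundPropagators, Thm 3.1 p.397 (bookkeeping)] -/
theorem exists_record₁₁CB10YZWB8subB12_leaves_iff (θ : Stage11Params F N) (h : θ.Provisos₁₁) (hθ : θ.Admissible) (hγ : 0 < θ.γ) (lam12 : ResidB12 F N θ.τ9.M)
    (lam : ResidB8 θ.toStage3Params) (Mstar : ℕ) (ops : OpsY N θ.toStage3Params Mstar) (ζ : ResidZ F N) (lamW : ResidW F N) :
    ∃ w : WorldP, IsRecordOfRecord₁₁CB10YZWB8subB12 F N (datumOfRecord₁₁ F N θ h) w ∧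
      (∀ P, w.up P = upOfRecord₅CS F N (θ.view₁₁B12B8subB10YZW F N lam12 lam Mstar ops ζ lamW) P) ∧
      ∀ P : B12.RunParams, ((leavesP w P).b8 ↔ B8LeafOfRecordSub θ.toStage3Params lam) ∧
        ((leavesP w P).b9 ↔ B9LeafX (Y9OfRecord N θ.toStage3Params Mstar ops)) := by
  obtain ⟨w₀, -, -⟩ := exists_world_isRecordOfRecord₁₁C F N θ h hθ ⟨hγ, le_rfl⟩
  refine ⟨{ w₀ with
      C := (datumOfRecord₁₁ F N θ h).C, γ := θ.γ, L := (θ.L : ℝ), one_lt_L := by exact_mod_cast θ.hL.2,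
      up := fun P => upOfRecord₅CS F N (θ.view₁₁B12B8subB10YZW F N lam12 lam Mstar ops ζ lamW) P },
    ⟨θ, h, lam12, lam, Mstar, ops, ζ, lamW, hθ, rfl, rfl, ⟨hγ, le_rfl⟩, rfl, fun _ => rfl⟩, fun _ => rfl, fun P => ?_⟩
  exact ⟨(upOfRecord₅CS_view₁₁B12B8subB10YZW_leaves F N θ lam12 lam Mstar ops ζ lamW P).2.1,
    (upOfRecord₅CS_view₁₁B12B8subB10YZW_leaves F N θ lam12 lam Mstar ops ζ lamW P).2.2.2.1⟩

/-- **THE STAGE-11-PRESENTED DICTIONARIES, BY NAME**: `S_N05` over the six-pin Sub record ⟺ «for every family, every admissible `θ : Stage11Params` with provisos and `γ > 0`,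
EVERY residual [B8] layer `λ`, floor and operator layer: `B9LeafX (Y9OfRecord N θ₃ M⋆ ops) → B8LeafOfRecordSub θ₃ λ`» (the [B12] ∕ [B11] ∕ [IV] layers drop out).
[cite: Balaban1985RegularSpaces, Lemma 1 – Thm 8 pp.79–101 (bookkeeping)] -/
theorem s_N05_iff₁₁CB10YZWB8subB12_bundles :
    S_N05 (fun F D w => IsRecordOfRecord₁₁CB10YZWB8subB12 F N D w) ↔
      ∀ (F : T4Family) (θ : Stage11Params F N) (_ : θ.Provisos₁₁), θ.Admissible → 0 < θ.γ →
        ∀ (lam : ResidB8 θ.toStage3Params) (Mstar : ℕ) (ops : OpsY N θ.toStage3Params Mstar),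
          B9LeafX (Y9OfRecord N θ.toStage3Params Mstar ops) → B8LeafOfRecordSub θ.toStage3Params lam := by
  refine ⟨fun hS F θ h hθ hγ lam Mstar ops h9 => ?_, fun H F D w h P => ?_⟩
  · obtain ⟨lam12⟩ := nonempty_residB12 F N θ.τ9.M
    obtain ⟨ζ⟩ := nonempty_residZ F N
    obtain ⟨lamW⟩ := nonempty_residW F N
    obtain ⟨w, hw, -, hiff⟩ := exists_record₁₁CB10YZWB8subB12_leaves_iff θ h hθ hγ lam12 lam Mstar ops ζ lamW
    let P₀ : B12.RunParams := ⟨0, 0, 0⟩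
    exact (hiff P₀).1.1 ((b8_main_iff_edge_of_isRecordOfRecord₁₁CB10YZWB8subB12 hw P₀).1 (hS F _ w hw P₀) ((hiff P₀).2.2 h9))
  · obtain ⟨θ, hP, lam12, lam, Mstar, ops, ζ, lamW, hθ, -, -, hγ, -, hup⟩ := h
    exact b8_main_of_up_view₁₁B12B8subB10YZW θ lam12 lam Mstar ops ζ lamW w hup (H F θ hP hθ (hγ.1.trans_le hγ.2) lam Mstar ops) P

/-- **THE ∀-FORM OVER THE SIX-PIN SUB RECORD IS REFUTED BY ONE ADMISSIBLE STAGE-11 PARAMETER** (with provisos and `γ > 0`): def-Y's zero operator layer makes the [B9] leaf TRUE,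
the degenerate residual [B8] layer of `exists_residB8_not_b8LeafOfRecordSub` makes the sub-family [B8] leaf FALSE, and the package presents a record.  The index re-key cures
J2 (the SOCKET binder of the knit), not the ∀-form: the count line at this record is the ∃∕slots form with a NAMED `λ`; nothing of print is refuted.
[cite: Balaban1985RegularSpaces, Prop. 5 p.94 (bookkeeping); Balaban1985BackgroundPropagators, Thms 3.1–3.15 pp.397–432 (junk satisfiability of the typed leaf)] -/
theorem not_s_N05_record₁₁CB10YZWB8subB12 (θ : Stage11Params F N) (h : θ.Provisos₁₁) (hθ : θ.Admissible) (hγ : 0 < θ.γ) :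
    ¬ S_N05 (fun F D w => IsRecordOfRecord₁₁CB10YZWB8subB12 F N D w) := by
  intro hS
  obtain ⟨lam, hlam⟩ := exists_residB8_not_b8LeafOfRecordSub θ.toStage3Params
  obtain ⟨ops, -, hleaf⟩ := exists_junkOps_b9LeafX_Y9OfRecord (N := N) θ.toStage3Params hθ.1.1.1.1.1 0
  exact hlam (s_N05_iff₁₁CB10YZWB8subB12_bundles.1 hS F θ h hθ hγ lam 0 ops hleaf)

variable (F) in
/-- **INHABITED at the six-pin Sub record ⟺ INHABITED-AT-₁₁C, family by family** (the six pins add no proviso): the companion one way; g32's rebind for ANY residual layers the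
other way (`nonempty_residB12`, `nonempty_residB8`, def-Y's junk operator layer, `nonempty_residZ`, `nonempty_residW`). [cite: Balaban1989LargeFieldII, Thm 1 + (0.1) pp.355–356 (bookkeeping)] -/
theorem inhabited₁₁CB10YZWB8subB12_iff_inhabited₁₁C :
    (∃ (D : Datum F N) (w : WorldP), IsRecordOfRecord₁₁CB10YZWB8subB12 F N D w) ↔
      ∃ (D : Datum F N) (w : WorldP), IsRecordOfRecord₁₁C F N D w := by
  refine ⟨fun ⟨D, w, h⟩ => ?_, fun ⟨D, w, h⟩ => ?_⟩
  · obtain ⟨w', hw', -⟩ := exists_isRecordOfRecord₁₁C_of_isRecordOfRecord₁₁CB10YZWB8subB12 h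
    exact ⟨D, w', hw'⟩
  · obtain ⟨θ, _, hθ, -, h11⟩ := isRecordOfRecord₁₁CB10YZWB8subB12_rebind_of_isRecordOfRecord₁₁C h
    obtain ⟨lam12⟩ := nonempty_residB12 F N θ.τ9.M
    obtain ⟨lam⟩ := nonempty_residB8 (θ := θ.toStage3Params)
    obtain ⟨ops, -, -⟩ := exists_junkOps_b9LeafX_Y9OfRecord (N := N) θ.toStage3Params hθ.1.1.1.1.1 0
    obtain ⟨ζ⟩ := nonempty_residZ F N
    obtain ⟨lamW⟩ := nonempty_residW F N
    exact ⟨D, _, h11 lam12 lam 0 ops ζ lamW⟩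

/-- **WHAT N05 COSTS AT THE SUB-FAMILY PIN IN K1's ∃-CURRENCY (LOCATED)**: every Stage-11 record `(D, w)` of `IsRecordOfRecord₁₁C` is RE-PRESENTED — SAME datum, construction,
window and block size — for EVERY residual [B8] layer `λ` OF THE PROVER'S CHOICE (any [B12] layer, floor `0`, def-Y's zero operator layer) by a six-pin Sub world `w′` at which
`Dag.B8_main (leavesP w′ P) ⟺ B8LeafOfRecordSub θ₃ λ` at EVERY run — i.e. the N05 conjunct at the chosen record IS the sub-family leaf for a NAMED `λ` = exactly the slot the
letters-fed knit fills (sockets `SockLetters`, `SockP5uE`, `SB9all` on the law members + the five printed members + `3·(2dL²)·B_G·B_R ≤ λ.inp.B₀′`).  NOT-A-DISCHARGE.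
[cite: Balaban1985RegularSpaces, Lemma 1 – Thm 8 pp.79–101 (bookkeeping: the node at the re-presented Stage-11 record)] -/
theorem exists_rebind₁₁CB10YZWB8subB12_of_isRecordOfRecord₁₁C {D : FiniteEpsData F (Node00.SU N)} {w : WorldP} (h : IsRecordOfRecord₁₁C F N D w) :
    ∃ θ : Stage11Params F N, θ.Admissible ∧ w.L = (θ.L : ℝ) ∧ ∀ lam : ResidB8 θ.toStage3Params,
      ∃ w' : WorldP, IsRecordOfRecord₁₁CB10YZWB8subB12 F N D w' ∧ w'.C = w.C ∧ w'.γ = w.γ ∧ w'.L = w.L ∧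
        ∀ P : B12.RunParams, Dag.B8_main (leavesP w' P) ↔ B8LeafOfRecordSub θ.toStage3Params lam := by
  obtain ⟨θ, hP, hθ, hD, hC, hγ, hL, hup⟩ := h
  refine ⟨θ, hθ, hL, fun lam => ?_⟩
  obtain ⟨lam12⟩ := nonempty_residB12 F N θ.τ9.M
  obtain ⟨ops, -, hleaf⟩ := exists_junkOps_b9LeafX_Y9OfRecord (N := N) θ.toStage3Params hθ.1.1.1.1.1 0
  obtain ⟨ζ⟩ := nonempty_residZ F N
  obtain ⟨lamW⟩ := nonempty_residW F N
  have hrec : IsRecordOfRecord₁₁CB10YZWB8subB12 F N D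
      { w with up := fun P => upOfRecord₅CS F N (θ.view₁₁B12B8subB10YZW F N lam12 lam 0 ops ζ lamW) P } :=
    ⟨θ, hP, lam12, lam, 0, ops, ζ, lamW, hθ, hD, hC, hγ, hL, fun _ => rfl⟩
  refine ⟨_, hrec, rfl, rfl, rfl, fun P => ?_⟩
  refine ⟨fun h8 => ?_, fun hl => b8_main_of_up_view₁₁B12B8subB10YZW θ lam12 lam 0 ops ζ lamW _ (fun _ => rfl) (fun _ => hl) P⟩
  obtain ⟨-, h5, h6, h7⟩ := b4_b5_b6_b7_of_isRecordOfRecord₁₁CB10YZWB8subB12 hrec P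
  exact (upOfRecord₅CS_view₁₁B12B8subB10YZW_leaves F N θ lam12 lam 0 ops ζ lamW P).2.1.1
    (h8 h5 h6 h7 ((upOfRecord₅CS_view₁₁B12B8subB10YZW_leaves F N θ lam12 lam 0 ops ζ lamW P).2.2.2.1.2 hleaf))

end Guards


/-! ## §4 (v1.1) THE KNIT AT THE SUB-FAMILY PIN — the slot `B8LeafOfRecordSub θ λ` FROM THE [4]-LETTERS SOCKET (`B8LeafKnitZd3Letters.b8LeafRS_zd3_map_lettersE` at
`ι := fun j : IdxB8Sub θ => j.1.1`, laws by node00-def's `IdxB8Laws.tower_all ∕ trunc_lt ∕ trunc_top`) -/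

section KnitLetters

variable {F : T4Family}

open Literature.MathematicalPhysics.QuantumFieldTheory.Balaban1983to89.B8LeafModelZd (ZdIdx)
open Literature.MathematicalPhysics.QuantumFieldTheory.Balaban1983to89.B8LeafModelZdSockP5uE (SockP5uE)
open Literature.MathematicalPhysics.QuantumFieldTheory.Balaban1983to89.B8LeafModelZd3 (SockB9P3)
open Literature.MathematicalPhysics.QuantumFieldTheory.Balaban1983to89.B8LeafModelZdSockLetters (SockLetters)
open Literature.MathematicalPhysics.QuantumFieldTheory.Balaban1983to89.B8LeafKnitZd3Letters (b8LeafRS_zd3_map_lettersE)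

/-- **THE SUB-FAMILY LEAF OF RECORD FROM THE [4]-LETTERS SOCKET** — `B8LeafOfRecordSub θ λ` (node00-def g32's surviving leaf over the sub-index of record `IdxB8Sub θ`) for a
residual layer `λ` with `λ.B₁′ = 5dL·B₀`, `2 ≤ 5dL·B₀`, `B₀(β₀) > 0`, `C₂ ≥ 2097152(d+1)²`, and THE FREE-CONSTANT CONDITION `3·(2dL²)·B_G·B_R ≤ λ.inp.B₀′`, from: the letters socket
`SockLetters θ.L B_G B_R B₀′_H B₂′ c_L` ([4] Thms 3.1–3.3) and Prop. 5's uniqueness socket `SockP5uE` ON THE LAW MEMBERS (`IdxB8Laws θ.L i`), the b9 socket `SB9all` at every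
member, and the five printed members `p5e p5u p6 p7 t8S` over the sub-family — `B8LeafKnitZd3Letters.b8LeafRS_zd3_map_lettersE` (this seat: the Prop-5 fixed-point sockets
`SockHFP₀`∕`SockHFP` DISCHARGED by `exists_threshold_sockHFP_pair`; n05-a g7's ι-generic chain underneath) at `ι := fun j : IdxB8Sub θ => j.1.1`, the member laws (L1)∕(L2) by
`IdxB8Laws.tower_all ∕ trunc_lt ∕ trunc_top`.  NOT a discharge of N05 (three sockets + five members remain hypotheses).
[cite: Balaban1985RegularSpaces, Lemma 1 p.79, Thm 2 p.83, Prop. 3 p.87, Thm 4 p.88, Prop. 5 (1.106)–(1.109) p.94 (kernel instances + letters route); Prop. 6 p.99, Prop. 7 p.100, Thm 8 p.101 (named hypotheses); Balaban1985BackgroundPropagators, Thms 3.1–3.3 pp.397–398 (the letters, hypotheses)] -/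
theorem b8LeafOfRecordSub_of_knit_lettersE {θ : Stage3Params} (lam : ResidB8 θ) (hD : 2 ≤ θ.D) (hB₁' : lam.B₁' = 5 * (θ.D : ℝ) * θ.L * lam.inp.B₀)
    {cu cu' cB9 B₀'H B₂' BG BR cL : ℝ} (hB : 2 ≤ 5 * (θ.D : ℝ) * θ.L * lam.inp.B₀) (hB₀β : 0 < lam.B₀β) (hC₂ : 2097152 * ((θ.D : ℝ) + 1) ^ 2 ≤ lam.C₂)
    (hcu : 0 < cu) (hcu' : 0 < cu') (hcB9 : 0 < cB9) (hB₀'H : 0 < B₀'H) (hB₂' : 0 ≤ B₂') (hBG : 0 ≤ BG) (hBR : 0 ≤ BR) (hcL : 0 < cL)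
    (hfree : 3 * (2 * (θ.D : ℝ) * (θ.L : ℝ) ^ 2) * BG * BR ≤ lam.inp.B₀')
    (SLet : ∀ i : ZdIdx θ.D θ.L, IdxB8Laws θ.L i → SockLetters (𝔸 := θ.𝔸) θ.L BG BR B₀'H B₂' cL i.η i.k i.Ω i.Λs)
    (SP5u : ∀ i : ZdIdx θ.D θ.L, IdxB8Laws θ.L i → SockP5uE (𝔸 := θ.𝔸) θ.L lam.inp.B₀ cu' cu i.η i.k i.Ω i.Λs)
    (SB9all : ∀ i : ZdIdx θ.D θ.L, ∀ m, m ≤ i.k → SockB9P3 (𝔸 := θ.𝔸) θ.L lam.inp.B₀ lam.B₀β cB9 lam.β lam.len i.η m i.Ω i.Λs i.Λb)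
    (p5e : B8.Prop5Exists lam.inp.B₀' lam.B₁ lam.lan) (p5u : B8.Prop5Unique lam.lan) (p6 : B8.Prop6Printed θ.D (θ.L : ℝ) lam.B₁ lam.c₁ lam.cub)
    (p7 : B8SectGH.Prop7PrintedR (fun j : IdxB8Sub θ => famB8OfRecord θ lam.β lam.len j.1) (fun j => lam.toAxial j.1))
    (t8 : B8Thm8Surviving.Thm8SurvivingAt 1 lam.B₁ lam.B₂ (fun j : IdxB8Sub θ => famB8OfRecord θ lam.β lam.len j.1)) :
    B8LeafOfRecordSub θ lam := by
  rw [B8LeafOfRecordSub, hB₁']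
  exact b8LeafRS_zd3_map_lettersE hD θ.two_le_L θ.L lam.β lam.len lam.inp hB hB₀β hC₂ hcu hcu' hcB9 hB₀'H hB₂' hBG hBR hcL hfree
    (fun j : IdxB8Sub θ => j.1.1) (fun j => j.1.2) (fun j => j.2.tower_all) (fun j => j.2.trunc_lt) (fun j => j.2.trunc_top)
    (fun j => SLet j.1.1 j.2) (fun j => SP5u j.1.1 j.2) (fun j => SB9all j.1.1) p5e p5u p6 p7 t8

/-- **THE KNIT AT ₁₁, SUB-FAMILY PIN, LETTERS CURRENCY** — `Dag.B8_main` at every run of any world bound over g32's six-pin view `θ.view₁₁B12B8subB10YZW λ₁₂ λ M⋆ ops ζ λ_W` FROM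
EXACTLY the hypotheses of `b8LeafOfRecordSub_of_knit_lettersE` at the chosen `(θ, λ)` (`b8_main_of_up_view₁₁B12B8subB10YZW_of_leafSub`).  This is the N05 conjunct in K1's
∃-currency at the record the prover chooses; sockets `SockLetters` ∕ `SockP5uE` ∕ `SB9all` and `p5e p5u p6 p7 t8S` remain.  NOT a discharge of N05.
[cite: Balaban1985RegularSpaces, Lemma 1 – Thm 8 pp.79–101; Balaban1985BackgroundPropagators, Thms 3.1–3.3 pp.397–398] -/
theorem b8_main_of_up_view₁₁B12B8subB10YZW_of_knit_lettersE (θ : Stage11Params F N) (hD : 2 ≤ θ.D) (lam12 : ResidB12 F N θ.τ9.M)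
    (lam : ResidB8 θ.toStage3Params) (Mstar : ℕ) (ops : OpsY N θ.toStage3Params Mstar) (ζ : ResidZ F N) (lamW : ResidW F N) (w : WorldP)
    (hup : ∀ P, w.up P = upOfRecord₅CS F N (θ.view₁₁B12B8subB10YZW F N lam12 lam Mstar ops ζ lamW) P)
    (hB₁' : lam.B₁' = 5 * (θ.D : ℝ) * θ.L * lam.inp.B₀) {cu cu' cB9 B₀'H B₂' BG BR cL : ℝ} (hB : 2 ≤ 5 * (θ.D : ℝ) * θ.L * lam.inp.B₀)
    (hB₀β : 0 < lam.B₀β) (hC₂ : 2097152 * ((θ.D : ℝ) + 1) ^ 2 ≤ lam.C₂) (hcu : 0 < cu) (hcu' : 0 < cu') (hcB9 : 0 < cB9) (hB₀'H : 0 < B₀'H)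
    (hB₂' : 0 ≤ B₂') (hBG : 0 ≤ BG) (hBR : 0 ≤ BR) (hcL : 0 < cL) (hfree : 3 * (2 * (θ.D : ℝ) * (θ.L : ℝ) ^ 2) * BG * BR ≤ lam.inp.B₀')
    (SLet : ∀ i : ZdIdx θ.D θ.L, IdxB8Laws θ.L i → SockLetters (𝔸 := θ.𝔸) θ.L BG BR B₀'H B₂' cL i.η i.k i.Ω i.Λs)
    (SP5u : ∀ i : ZdIdx θ.D θ.L, IdxB8Laws θ.L i → SockP5uE (𝔸 := θ.𝔸) θ.L lam.inp.B₀ cu' cu i.η i.k i.Ω i.Λs)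
    (SB9all : ∀ i : ZdIdx θ.D θ.L, ∀ m, m ≤ i.k →
      SockB9P3 (𝔸 := θ.𝔸) θ.L lam.inp.B₀ lam.B₀β cB9 lam.β lam.len i.η m i.Ω i.Λs i.Λb)
    (p5e : B8.Prop5Exists lam.inp.B₀' lam.B₁ lam.lan) (p5u : B8.Prop5Unique lam.lan) (p6 : B8.Prop6Printed θ.D (θ.L : ℝ) lam.B₁ lam.c₁ lam.cub)
    (p7 : B8SectGH.Prop7PrintedR (fun j : IdxB8Sub θ.toStage3Params => famB8OfRecord θ.toStage3Params lam.β lam.len j.1) (fun j => lam.toAxial j.1))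
    (t8 : B8Thm8Surviving.Thm8SurvivingAt 1 lam.B₁ lam.B₂ (fun j : IdxB8Sub θ.toStage3Params => famB8OfRecord θ.toStage3Params lam.β lam.len j.1))
    (P : B12.RunParams) : Dag.B8_main (leavesP w P) :=
  b8_main_of_up_view₁₁B12B8subB10YZW_of_leafSub θ lam12 lam Mstar ops ζ lamW w hup
    (b8LeafOfRecordSub_of_knit_lettersE lam hD hB₁' hB hB₀β hC₂ hcu hcu' hcB9 hB₀'H hB₂' hBG hBR hcL hfree SLet SP5u SB9all p5e p5u p6 p7 t8) P

end KnitLetters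

end Summit.QuantumFields.YangMills.BalabanUVNodes.N05AtRecord11Sub

end
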